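import Summits.CriticalPhenomena.PercolationContinuityZ3.Theorems.PercNearOneGluingNoHeavyQuantCompSlice
import Summits.CriticalPhenomena.PercolationContinuityZ3.Theorems.PercNearOneGluingNoHeavyQuantHullHigh
import Summits.CriticalPhenomena.PercolationContinuityZ3.Theorems.PercNearOneGluingNoHeavyQuantConvAtoms
import HarnessLib

/-!
# QUANT lane R8, T-DEC: **HIGH-CONV** — an SDEC law convolved with a HIGH law stays SDEC (prim-quant-census-1 g29 §3's untried item, a corollary
# of COMP-SLICE: a high law is a same-mean mixture of light pieces); so ONE high / hull+high sibling is free on the node's binder (arm-1 gen 57)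

builds on p205010 (kernel theorem, internal audit signed; external expert review pending)

Support file (`--supports stmt-CriticalPhenomena-4575`), QUANT lane seat prim-quant-arm-1 (gen 57, architect); memo
`run/shared/lean/prim/quant/prim-quant-arm-1-g57/ARCH-G57.md` §0 (1), §0 (5).  Theorems only; standard axioms, no sorries.

HIGH-CONV.  `β` a probability law on `{0..B}`, affordable and SDEC at `0 < x < 1`; `H` HIGH at `x` (census-1 g29 `LawDec.IsHigh x m M H`: probability law on
`{0..M}`, mean `m`, affordable `x·M ≤ m`, every charged atom `h` with `m ≤ 2h`) ⟹ `SDEC x (M + B) (H ∗ β)`.  PROOF: Lemma P (`exists_twoPoint_decomposition`)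
writes `H` as a mixture of two-point laws `{lo, hi; g}` of mean `m` on its charged atoms; a charged `lo` has `2lo ≥ m`, i.e. the piece is LIGHT
(`(hi − lo)g = m − lo ≤ lo`), and affordable (`x·hi ≤ x·M ≤ m`); COMP-SLICE (✓ `sdec_lightPiece`, this seat) makes every `{lo,hi;g} ∗ β` SDEC, the declared
top is raised to `M + B` (`sdec_mono_top`), and SDEC is convex along same-mean mixtures (`sdec_of_mixture_finset`); `lconv` is linear (`lconv_sum_left`).
USE: with census-1 g29's hull+high criterion (`sdec_flaw_of_hullHigh`: forests ALL of whose siblings are hull+high decomposable) this is the missing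
"one more sibling" step — a HIGH sibling law can be adjoined to ANY SDEC affordable law; together with the blob slice (`sdec_slice'`, `HullHigh`'s blob
part) one hull+high sibling is free on the node's binder, like one tame sibling (✓ `sdec_cons_of_tame`).

* `lconv_tp_eq_lightPiece` (bookkeeping: `{lo,hi;g} ∗ β` with declared top `M` is the light-piece law `TPL[lo, hi−lo, g] ∗ β`),
  **`sdec_lconv_high`** (HIGH-CONV).

HONEST STATUS.  `SiblingStep` / `GateStepN` / `LightResidDECOracle` / `FarTreeRow` OPEN (all-heavy-unfloored residue); RATE class (log\*) / honest sentence
of `run/shared/lean/prim/quant/README.md` unchanged.  [this work]; `IsHigh`, hull+high: prim-quant-census-1 g29; cell L2 behind COMP-SLICE: prim-quant-arm-2 g37.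
Nothing here is cited as a published result.  The gluing rows served [cite: KozmaNitzan2024, Conjecture 3 (p. 15)]; product measure
[cite: Grimmett1999, §1.3 p. 10].
-/

noncomputable section

open scoped BigOperators

namespace Summit.CriticalPhenomena.PercolationContinuityZ3.Theorems
namespace Quant

open Finset

/-- the two-point law `{lo, hi; g}` (as in `…QuantLawDEC`) -/
local notation3 "TP[" lo ", " hi ", " g ", " h "]" =>
  (g : ℝ) * (if (h : ℕ) = (hi : ℕ) then (1 : ℝ) else 0) + (1 - (g : ℝ)) * (if (h : ℕ) = (lo : ℕ) then (1 : ℝ) else 0)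

namespace LawDec

/-- the point mass `δ_K` -/
local notation3 "δ[" K "]" => (fun k : ℕ => if k = (K : ℕ) then (1 : ℝ) else 0)

/-- the two-point law `{lo, lo+K; g}` = `lo` sure relays and a blob of size `K` at gate `g` -/
local notation3 "TPL[" lo ", " K ", " g "]" => lconv lo K δ[lo] (gate δ[K] g)

/-- **bookkeeping**: for `lo ≤ hi ≤ M` and `β` vanishing above `B`, `lconv M B {lo,hi;g} β = lconv (lo + (hi−lo)) B TPL[lo, hi−lo, g] β` pointwise —
the same law with the piece's own declared top. [this work] -/
theorem lconv_tp_eq_lightPiece (M B lo hi : ℕ) (g : ℝ) (β : ℕ → ℝ) (hg0 : 0 ≤ g) (hg1 : g ≤ 1) (hlohi : lo ≤ hi) (hhi : hi ≤ M) (h : ℕ) :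
    lconv M B (fun k => TP[lo, hi, g, k]) β h = lconv (lo + (hi - lo)) B (TPL[lo, hi - lo, g]) β h := by
  have ehi : lo + (hi - lo) = hi := by omega
  have eT : (TPL[lo, hi - lo, g]) = fun k => TP[lo, hi, g, k] := by
    funext k; rw [tpLaw_apply lo (hi - lo) g k, ehi]
  rw [eT, ehi]
  refine lconv_top_left_of_le hi M B _ β hhi (fun k hk => ?_) h
  have := (hs_facts lo (hi - lo) g hg0 hg1).2.1 k (by omega)
  rw [eT] at this
  exact this

/-- **HIGH-CONV.**  `β` a probability law on `{0..B}`, affordable (`x·B ≤ mean`) and SDEC at `0 < x < 1`; `H` high at `x` with mean `m` and top `M`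
(`IsHigh x m M H`) ⟹ `SDEC x (M + B) (lconv M B H β)`. [this work] -/
theorem sdec_lconv_high {x m : ℝ} {M B : ℕ} {H β : ℕ → ℝ} (hx0 : 0 < x) (hx1 : x < 1) (hH : IsHigh x m M H)
    (β0 : ∀ h, 0 ≤ β h) (βM : ∀ h, B < h → β h = 0) (β1 : ∑ h ∈ Finset.range (B + 1), β h = 1)
    (hta : x * (B : ℝ) ≤ ∑ h ∈ Finset.range (B + 1), (h : ℝ) * β h) (hS : SDEC x B β) :
    SDEC x (M + B) (lconv M B H β) := by
  classical
  obtain ⟨h0, hM, h1, hmean, hhigh, htaH⟩ := hH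
  set S : ℝ := ∑ h ∈ Finset.range (B + 1), (h : ℝ) * β h with hSdef
  -- Lemma P on `H`
  obtain ⟨lam, g, lo, hi, l0, l1, hg, hlohi, hhi, hHsum, hgen⟩ := exists_twoPoint_decomposition M M le_rfl H h0 hM h1
  rw [hmean] at hgen
  -- the components `{lo r, hi r; g r} ∗ β` with declared tops `M`, `B`
  set ν : Fin (M + 1) × Fin (M + 1) → ℕ → ℝ := fun r => lconv M B (fun k => TP[lo r, hi r, g r, k]) β with hν
  have hmix : lconv M B H β = fun h => ∑ r, lam r * ν r h := by
    funext h
    have eH : H = fun k => ∑ r, lam r * TP[lo r, hi r, g r, k] := funext hHsum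
    rw [eH, lconv_sum_left]
  rw [hmix]
  refine sdec_of_mixture_finset Finset.univ lam ν x (m + S) (M + B) (fun r _ => l0 r) (by simpa using l1) (fun r _ hr => ?_)
    (fun r _ hr => ?_)
  all_goals
    obtain ⟨hclo, _, hmr, _⟩ := hgen r hr
    set K : ℕ := hi r - lo r with hK
    have hlh := hlohi r
    have ehi : lo r + K = hi r := by rw [hK]; omega
    have hKr : (K : ℝ) = (hi r : ℝ) - lo r := by
      have : ((lo r + K : ℕ) : ℝ) = hi r := by rw [ehi]
      push_cast at this; linarith
    -- light and affordable
    have hlight : (K : ℝ) * g r ≤ lo r := by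
      have := hhigh (lo r) hclo; rw [hKr]; nlinarith
    have hKg : (K : ℝ) * g r = ((hi r : ℝ) - lo r) * g r := by rw [hKr]
    have haff : x * ((lo r : ℝ) + K) ≤ lo r + K * g r := by
      have e1 : (lo r : ℝ) + K = hi r := by linarith [hKr]
      have e2 : (lo r : ℝ) + K * g r = m := by linarith [hmr, hKg]
      rw [e1, e2]
      calc x * (hi r : ℝ) ≤ x * M := mul_le_mul_of_nonneg_left (by exact_mod_cast hhi r) hx0.le
        _ ≤ m := htaH
    -- the component is the light-piece law with its own top `hi r + B`
    have eν : ν r = lconv (lo r + K) B (TPL[lo r, K, g r]) β :=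
      funext fun h => lconv_tp_eq_lightPiece M B (lo r) (hi r) (g r) β (hg r).1 (hg r).2 (hlohi r) (hhi r) h
    obtain ⟨p0, pM, p1, pmn, _⟩ := hs_facts (lo r) K (g r) (hg r).1 (hg r).2
    have c0 : ∀ h, 0 ≤ lconv (lo r + K) B (TPL[lo r, K, g r]) β h := lconv_nonneg _ _ _ _ p0 β0
    have cM : ∀ h, lo r + K + B < h → lconv (lo r + K) B (TPL[lo r, K, g r]) β h = 0 := fun h hh => lconv_eq_zero _ _ _ _ h hh
    have c1 : ∑ h ∈ Finset.range (lo r + K + B + 1), lconv (lo r + K) B (TPL[lo r, K, g r]) β h = 1 := sum_lconv _ _ _ _ p1 β1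
    have cmn : ∑ h ∈ Finset.range (lo r + K + B + 1), (h : ℝ) * lconv (lo r + K) B (TPL[lo r, K, g r]) β h = m + S := by
      rw [sum_mul_lconv _ _ _ _ p1 β1, pmn]
      linarith [hmr, hKg, hSdef]
    have htop : lo r + K + B ≤ M + B := by rw [ehi]; exact Nat.add_le_add_right (hhi r) B
  · -- the common mean `m + S` on `{0..M+B}`
    rw [eν, ← cmn]
    exact sum_range_top_mono (lo r + K + B) (M + B) htop _ (fun h hh => by rw [cM h hh, mul_zero])
  · -- SDEC of the component at the common top: COMP-SLICE, then raise the top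
    rw [eν]
    have hSr : SDEC x (lo r + K + B) (lconv (lo r + K) B (TPL[lo r, K, g r]) β) :=
      sdec_lightPiece hx0 hx1 β0 βM β1 hta hS (lo r) K (g r) (hg r).1 (hg r).2 hlight haff
    refine sdec_mono_top hx0 hx1 c0 cM c1 htop ?_ hSr
    rw [cmn]
    push_cast
    nlinarith [htaH, hta]

end LawDec
end Quant
end Summit.CriticalPhenomena.PercolationContinuityZ3.Theorems
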